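import Literature.NumberTheory.ModularForms.BinaryQuadGaussSumBasic
import Literature.NumberTheory.EllipticCurves.GaussSumSign
import HarnessLib

/-!
# Gauss sums of binary quadratic forms, III: `|G(t, k; c)| = √c`, the unramified value `(D/c)·c`,
# and the dependence on the numerator (`(a/s)`, `s = (c, D)`)

Topic `NumberTheory/ModularForms` (namespace `Literature.NumberTheory.ModularForms`), continuing
`BinaryQuadGaussSum.lean` / `BinaryQuadGaussSumBasic.lean`. Everything here is PROVED (theorems
only; no definition, no named fact). Inputs: the tree's one-variable theory
(`quadGaussSum_eq_jacobiSym_mul`: `G(a; n) = (a/n)G(1; n)`; Gauss's theorem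
`quadGaussSum_one_of_mod_four_eq_one/three`: `G(1; n) = √n`, `i√n`; completing the square
`stdAddChar_mul_quadGaussSum_two_mul`) and the diagonalisation / reduction of file II.
With `f = (A, B, C)`, `D = B² − 4AC`, an ODD modulus `c`:

* `quadGaussSum_one_sq`, `norm_quadGaussSum_one` — `G(1; c)² = (−1/c)·c`, `|G(1; c)| = √c`
  (Andrianov–Zhuravlev Ch. 1 (4.29) `G_p(1)² = (−1/p)p`, Lemma 4.14 `G_d(1) = ε_d√d`);
  `quadGaussSum_eq_stdAddChar_mul_quadGaussSum` (the twist is a phase when the quadratic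
  coefficient is a unit) and `norm_quadGaussSum_of_isUnit` — **`|G(t, k; c)| = √c`** for a unit `t`.
* `binQuadGaussSum_zero_zero_eq_mul` — `G(a, c; f, 0) = G(aA; c)·G(−aAD; c)` for `A` a unit mod `c`
  (the diagonal product with INTEGER coefficients: `G(u²t; c) = G(t; c)`).
* `binQuadGaussSum_zero_zero_eq_jacobiSym_mul` (and `…_of_isPrimitive`) — **the unramified value**
  `∑_{x,y mod c} e(a f(x,y)/c) = (D/c)·c` for `(c, 2aD) = 1` (and `(A, c) = 1`, resp. `f`
  primitive): Andrianov–Zhuravlev, Proposition 4.9 / (4.33), `χ_Q(p) = ((−1)^k det Q / p)` for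
  `m = 2k = 2` (`det Q = 4AC − B² = −D`), extended from primes to odd moduli by the Jacobi symbol.
* `binQuadGaussSum_zero_zero_eq_jacobiSym_mul_binQuadGaussSum_one` — **the dependence on the
  numerator**: if `c = s·c₁`, `D = s·D₁` with `(D₁, c₁) = 1` (so `s = (c, D)` when `D` is
  squarefree) and `(aA, c) = 1`, then `G(a, c; f, 0) = (a/s)·G(1, c; f, 0)` — the quadratic
  character `χ_s(a)` by which the numerator enters (for the class-group theta series of
  discriminant `−q` at a cusp `a/c` with `(c, q) = s` this is the `χ_s(a)` of the pseudo-eigenvalue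
  in Conrey–Iwaniec (3.15)/(3.17)); in particular `|G(a, c; f, 0)| = c√s`
  (`norm_binQuadGaussSum_zero_zero`).

## References

* A. N. Andrianov, V. G. Zhuravlev, *Modular Forms and Hecke Operators*, Transl. Math. Monogr.
  145, AMS (1995/2015), Ch. 1 §4.4 (4.27)–(4.29), Proposition 4.9, (4.33); §4.5 (4.48), Lemmas
  4.13, 4.14 [AndrianovZhuravlev2015] (held copy `book:andrianov2015-modular-forms-hecke-operators`,
  pp. 40–46).
* B. Conrey, H. Iwaniec, Acta Arith. 103 (2002) 259–312, §3 (3.15), (3.17) [ConreyIwaniec2002].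
* N. Koblitz, *Introduction to Elliptic Curves and Modular Forms*, GTM 97, Ch. IV §1 [KoblitzECMF1993]
  (Gauss's evaluation of `G(1; D)`, the tree's `GaussSumSign.lean`).
-/

noncomputable section

open Complex Finset

namespace Literature.NumberTheory.ModularForms

open Literature.NumberTheory.EllipticCurves.ModularForms
open Literature.NumberTheory.QuadraticFields.Quadratic (BinQF)
open Literature.NumberTheory.LFunctions (norm_stdAddChar)

open scoped NumberTheorySymbols

variable {c : ℕ} [NeZero c]

/-! ### One-variable sums to an odd modulus -/

omit [NeZero c] in
/-- `2` is a unit modulo an odd `c` (plumbing). [folklore] -/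
private theorem isUnit_two_zmod (hc : Odd c) : IsUnit (2 : ZMod c) := by
  have : ((2 : ℕ) : ZMod c) = 2 := by norm_cast
  rw [← this, ZMod.isUnit_iff_coprime]
  exact Nat.coprime_two_left.mpr hc

omit [NeZero c] in
/-- An integer prime to `c` is a unit mod `c` (plumbing). [folklore] -/
private theorem isUnit_intCast_of_gcd_eq_one {a : ℤ} (h : a.gcd c = 1) : IsUnit (a : ZMod c) := by
  obtain ⟨u, v, huv⟩ := Int.isCoprime_iff_gcd_eq_one.mpr h
  refine IsUnit.of_mul_eq_one (u : ZMod c) ?_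
  have := congrArg (fun x : ℤ ↦ (x : ZMod c)) huv
  simp only [Int.cast_add, Int.cast_mul, Int.cast_natCast, ZMod.natCast_self, mul_zero, add_zero,
    Int.cast_one] at this
  rw [mul_comm]
  exact this

/-- **`G(1; c)² = (−1/c)·c` for odd `c`** (`(−1/c) = χ₄(c)`; Andrianov–Zhuravlev (4.29)
`G_p(1)² = (−1/p)p`, here for every odd modulus from Gauss's evaluation `G(1; c) = √c`, `i√c`).
[cite: AndrianovZhuravlev2015, Ch. 1 §4.4 (4.29) with §4.5 Lemma 4.14] -/
theorem quadGaussSum_one_sq (hc : Odd c) :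
    quadGaussSum c 1 0 ^ 2 = (ZMod.χ₄ c : ℂ) * c := by
  have hsq : ((Real.sqrt c : ℝ) : ℂ) ^ 2 = (c : ℂ) := by
    rw [← Complex.ofReal_pow, Real.sq_sqrt (Nat.cast_nonneg c), Complex.ofReal_natCast]
  rcases Nat.odd_mod_four_iff.mp (Nat.odd_iff.mp hc) with h1 | h3
  · rw [quadGaussSum_one_of_mod_four_eq_one h1, hsq, ZMod.χ₄_nat_one_mod_four h1, Int.cast_one,
      one_mul]
  · rw [quadGaussSum_one_of_mod_four_eq_three h3, mul_pow, Complex.I_sq, hsq,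
      ZMod.χ₄_nat_three_mod_four h3, Int.cast_neg, Int.cast_one]

/-- **`|G(1; c)| = √c` for odd `c`** (Andrianov–Zhuravlev Lemma 4.14: `G_d(1) = ε_d·√d`,
`|ε_d| = 1`). [cite: AndrianovZhuravlev2015, Ch. 1 §4.5 Lemma 4.14] -/
theorem norm_quadGaussSum_one (hc : Odd c) : ‖quadGaussSum c 1 0‖ = Real.sqrt c := by
  rcases Nat.odd_mod_four_iff.mp (Nat.odd_iff.mp hc) with h1 | h3
  · rw [quadGaussSum_one_of_mod_four_eq_one h1, Complex.norm_real,
      Real.norm_of_nonneg (Real.sqrt_nonneg _)]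
  · rw [quadGaussSum_one_of_mod_four_eq_three h3, norm_mul, Complex.norm_I, one_mul,
      Complex.norm_real, Real.norm_of_nonneg (Real.sqrt_nonneg _)]

/-- **`G(t; c) = (t/c)·G(1; c)` for a unit residue `t` mod an odd `c`** — the tree's
`quadGaussSum_eq_jacobiSym_mul` (`G(a; n) = (a/n)G(1; n)` for integers `a` prime to `n`,
Andrianov–Zhuravlev Lemma 4.13) through the representative `t.val`.
[cite: AndrianovZhuravlev2015, Ch. 1 §4.5 Lemma 4.13] -/
theorem quadGaussSum_eq_jacobiSym_val_mul (hc : Odd c) {t : ZMod c} (ht : IsUnit t) :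
    quadGaussSum c t 0 = jacobiSym (t.val : ℤ) c * quadGaussSum c 1 0 := by
  have hcop : ((t.val : ℕ) : ℤ).gcd c = 1 := by
    rw [Int.gcd_natCast_natCast]
    have := ZMod.val_coe_unit_coprime ht.unit
    rwa [IsUnit.unit_spec] at this
  have hrep : (((t.val : ℕ) : ℤ) : ZMod c) = t := by
    rw [Int.cast_natCast, ZMod.natCast_zmod_val]
  conv_lhs => rw [← hrep]
  exact quadGaussSum_eq_jacobiSym_mul hc hcop

/-- **`|G(t; c)| = √c` for a unit `t` modulo an odd `c`.**
[cite: AndrianovZhuravlev2015, Ch. 1 §4.5 Lemmas 4.13–4.14] -/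
theorem norm_quadGaussSum_zero_of_isUnit (hc : Odd c) {t : ZMod c} (ht : IsUnit t) :
    ‖quadGaussSum c t 0‖ = Real.sqrt c := by
  have hcop : ((t.val : ℕ) : ℤ).gcd c = 1 := by
    rw [Int.gcd_natCast_natCast]
    have := ZMod.val_coe_unit_coprime ht.unit
    rwa [IsUnit.unit_spec] at this
  rw [quadGaussSum_eq_jacobiSym_val_mul hc ht, norm_mul, norm_quadGaussSum_one hc]
  rcases jacobiSym.eq_one_or_neg_one hcop with h | h <;> rw [h] <;> simp

/-- **Completing the square in one variable**: for odd `c` and `t d ≡ 1 (mod c)`,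
`G(t, k; c) = e(−d·(k/2)²/c)·G(t; c)` — the tree's `e(dl²/c)G(t, 2l; c) = G(t; c)` at `l = k/2`.
[cite: AndrianovZhuravlev2015, Ch. 1 §4.5 (4.51)] -/
theorem quadGaussSum_eq_stdAddChar_mul_quadGaussSum (hc : Odd c) {t d : ZMod c}
    (htd : t * d = 1) (k : ZMod c) :
    quadGaussSum c t k =
      (ZMod.stdAddChar (-(d * ((2 : ZMod c)⁻¹ * k) ^ 2)) : ℂ) * quadGaussSum c t 0 := by
  have h2 : (2 : ZMod c) * 2⁻¹ = 1 := ZMod.mul_inv_of_unit _ (isUnit_two_zmod hc)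
  have hk : 2 * (2⁻¹ * k) = k := by rw [← mul_assoc, h2, one_mul]
  have key := stdAddChar_mul_quadGaussSum_two_mul t d (2⁻¹ * k) htd
  rw [hk] at key
  rw [← key, ← mul_assoc, ← AddChar.map_add_eq_mul, neg_add_cancel, AddChar.map_zero_eq_one,
    one_mul]

/-- **`|G(t, k; c)| = √c` for a unit `t` modulo an odd `c` and ANY linear coefficient `k`**
(the twist is a phase). [cite: AndrianovZhuravlev2015, Ch. 1 §4.5 Lemmas 4.13–4.14] -/
theorem norm_quadGaussSum_of_isUnit (hc : Odd c) {t : ZMod c} (ht : IsUnit t) (k : ZMod c) :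
    ‖quadGaussSum c t k‖ = Real.sqrt c := by
  rw [quadGaussSum_eq_stdAddChar_mul_quadGaussSum hc (ZMod.mul_inv_of_unit t ht) k, norm_mul,
    norm_stdAddChar, one_mul, norm_quadGaussSum_zero_of_isUnit hc ht]

/-! ### The untwisted binary sum: diagonal product with integer coefficients -/

/-- For odd `c` and a form whose leading coefficient `A` is a unit mod `c`:
`G(a, c; f, 0) = G(aA; c) · G(−aAD; c)` (diagonalisation, then `G(u²t; c) = G(t; c)` with
`u = (4A)⁻¹`: `a(4A)⁻¹ = ((4A)⁻¹)²·4·(aA)` and `G(4t; c) = G(t; c)`).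
[cite: AndrianovZhuravlev2015, Ch. 1 §4.4, proof of Proposition 4.9] -/
theorem binQuadGaussSum_zero_zero_eq_mul (hc : Odd c) (f : BinQF) (hA : IsUnit (f.a : ZMod c))
    (a : ZMod c) :
    binQuadGaussSum c f a 0 0 =
      quadGaussSum c (a * (f.a : ZMod c)) 0 *
        quadGaussSum c (-(a * (f.a : ZMod c) * ((f.disc : ℤ) : ZMod c))) 0 := by
  set α : ZMod c := (f.a : ZMod c) with hα
  have h2 : IsUnit (2 : ZMod c) := isUnit_two_zmod hc
  have h4A : IsUnit (4 * α) := by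
    have : (4 : ZMod c) * α = 2 * (2 * α) := by ring
    rw [this]; exact h2.mul (h2.mul hA)
  have e4 : 4 * α * (4 * α)⁻¹ = 1 := ZMod.mul_inv_of_unit _ h4A
  have hu : IsUnit (4 * α)⁻¹ := IsUnit.of_mul_eq_one (4 * α) (by rw [mul_comm, e4])
  rw [binQuadGaussSum_eq_quadGaussSum_mul hc f hA a 0 0, zero_mul, mul_zero, sub_zero]
  congr 1
  · rw [show a * (4 * α)⁻¹ = (4 * α)⁻¹ ^ 2 * (4 * (a * α)) by
        linear_combination (-(a * (4 * α)⁻¹)) * e4,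
      quadGaussSum_unit_sq_mul hu, quadGaussSum_four_mul_left hc]
  · rw [show -(a * (4 * α)⁻¹ * ((f.disc : ℤ) : ZMod c)) =
          (4 * α)⁻¹ ^ 2 * (4 * -(a * α * ((f.disc : ℤ) : ZMod c))) by
        linear_combination (a * (4 * α)⁻¹ * ((f.disc : ℤ) : ZMod c)) * e4,
      quadGaussSum_unit_sq_mul hu, quadGaussSum_four_mul_left hc]

omit [NeZero c] in
/-- `χ₄(c)² = 1` for odd `c` (plumbing: `(−1/c)² = 1`). [folklore] -/
private theorem χ₄_sq (hc : Odd c) : ((ZMod.χ₄ c : ℤ) : ℂ) ^ 2 = 1 := by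
  have h : ((-1 : ℤ)).gcd c = 1 := by simp
  have := jacobiSym.sq_one h
  rw [jacobiSym.at_neg_one hc] at this
  exact_mod_cast congrArg (Int.cast (R := ℂ)) this

/-- **The unramified value of the binary Gauss sum**: for odd `c` prime to `a`, to the leading
coefficient `A` and to the discriminant `D` of `f`,
`∑_{x,y mod c} e(a f(x,y)/c) = (D/c)·c` (Jacobi symbol) — Andrianov–Zhuravlev, Proposition 4.9:
`p^{-k}∑_{l mod p} e(½Q[l]/p) = p^{-k}G_p(a₁)⋯G_p(a_m) = ((−1)^k det Q/p)` for `m = 2`, `k = 1`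
(`det Q = 4AC − B² = −D`), with `(aA/c)² = 1`, `G(1;c)² = (−1/c)c`, `(−1/c)² = 1`.
[cite: AndrianovZhuravlev2015, Ch. 1 §4.4 Proposition 4.9 with (4.33)] -/
theorem binQuadGaussSum_zero_zero_eq_jacobiSym_mul (hc : Odd c) (f : BinQF) {a : ℤ}
    (ha : a.gcd c = 1) (hA : f.a.gcd c = 1) (hD : f.disc.gcd c = 1) :
    binQuadGaussSum c f a 0 0 = jacobiSym f.disc c * c := by
  have hAu : IsUnit ((f.a : ℤ) : ZMod c) := isUnit_intCast_of_gcd_eq_one hA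
  have cop := fun {x : ℤ} (h : x.gcd c = 1) ↦ Int.isCoprime_iff_gcd_eq_one.mpr h
  have h1 : (a * f.a).gcd c = 1 := Int.isCoprime_iff_gcd_eq_one.mp ((cop ha).mul_left (cop hA))
  have h2 : (-(a * f.a * f.disc)).gcd c = 1 :=
    Int.isCoprime_iff_gcd_eq_one.mp (((cop ha).mul_left (cop hA)).mul_left (cop hD)).neg_left
  rw [binQuadGaussSum_zero_zero_eq_mul hc f hAu,
    show (a : ZMod c) * ((f.a : ℤ) : ZMod c) = ((a * f.a : ℤ) : ZMod c) by push_cast; ring,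
    show -(((a * f.a : ℤ) : ZMod c) * ((f.disc : ℤ) : ZMod c)) =
      ((-(a * f.a * f.disc) : ℤ) : ZMod c) by push_cast; ring,
    quadGaussSum_eq_jacobiSym_mul hc h1, quadGaussSum_eq_jacobiSym_mul hc h2, jacobiSym.neg _ hc,
    jacobiSym.mul_left (a * f.a) f.disc c]
  have hG := quadGaussSum_one_sq hc
  have hJ : ((jacobiSym (a * f.a) c : ℤ) : ℂ) ^ 2 = 1 := by exact_mod_cast jacobiSym.sq_one h1
  have hχ := χ₄_sq hc
  push_cast
  linear_combination ((ZMod.χ₄ c : ℤ) : ℂ) * (jacobiSym f.disc c : ℂ) *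
      ((jacobiSym (a * f.a) c : ℂ) ^ 2) * hG +
    ((ZMod.χ₄ c : ℤ) : ℂ) ^ 2 * (jacobiSym f.disc c : ℂ) * (c : ℂ) * hJ +
    (jacobiSym f.disc c : ℂ) * (c : ℂ) * hχ

/-- **The unramified value for a PRIMITIVE form** (no condition on the leading coefficient: move
first to a properly equivalent form with `(A, c) = 1`, Cox Lemma 2.25, which changes neither the
untwisted sum nor `D`): for odd `c` with `(c, aD) = 1`,
`∑_{x,y mod c} e(a f(x,y)/c) = (D/c)·c`. [cite: AndrianovZhuravlev2015, Ch. 1 §4.4 Proposition 4.9 with (4.33)] -/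
theorem binQuadGaussSum_zero_zero_eq_jacobiSym_mul_of_isPrimitive (hc : Odd c) {f : BinQF}
    (hf : f.IsPrimitive) {a : ℤ} (ha : a.gcd c = 1) (hD : f.disc.gcd c = 1) :
    binQuadGaussSum c f a 0 0 = jacobiSym f.disc c * c := by
  obtain ⟨g, ⟨p, q, r, s, hdet, rfl⟩, hco⟩ :=
    BinQF.exists_properEquiv_isCoprime_a hf (M := (c : ℤ)) (Int.natCast_ne_zero.mpr (NeZero.ne c))
  have hdisc : (f.act p q r s).disc = f.disc := by rw [BinQF.disc_act, hdet, one_pow, one_mul]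
  rw [← binQuadGaussSum_zero_zero_eq_of_properEquiv ⟨p, q, r, s, hdet, rfl⟩, ← hdisc]
  refine binQuadGaussSum_zero_zero_eq_jacobiSym_mul hc _ ha (Int.isCoprime_iff_gcd_eq_one.mp hco) ?_
  rw [hdisc]; exact hD

/-! ### The dependence on the numerator: `G(a, c; f, 0) = (a/s)·G(1, c; f, 0)` -/

/-- Closed form of the untwisted sum along a factorisation `c = s·c₁`, `D = s·D₁` with
`(D₁, c₁) = 1`, for `(aA, c) = 1` (odd `c`):
`G(a, c; f, 0) = (a/c)(a/c₁) · (A/c)G(1;c) · s · (−AD₁/c₁)G(1;c₁)`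
(first factor `G(aA; c) = (aA/c)G(1;c)`; second factor `G(−aAD; c) = G(s·(−aAD₁); s·c₁)
= s·G(−aAD₁; c₁) = s(−aAD₁/c₁)G(1;c₁)` by the reduction of the modulus).
[cite: AndrianovZhuravlev2015, Ch. 1 §4.4–4.5, proof of Proposition 4.9 and Lemma 4.13] -/
theorem binQuadGaussSum_zero_zero_eq_of_factorisation (hc : Odd c) (f : BinQF)
    (hA : f.a.gcd c = 1) {s c₁ : ℕ} [NeZero s] [NeZero c₁] (hcs : c = s * c₁) {D₁ : ℤ}
    (hD : f.disc = s * D₁) (hD₁ : D₁.gcd c₁ = 1) {a : ℤ} (ha : a.gcd c = 1) :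
    binQuadGaussSum c f a 0 0 =
      (jacobiSym a c * jacobiSym a c₁ : ℤ) *
        ((jacobiSym f.a c : ℂ) * quadGaussSum c 1 0 * s *
          ((jacobiSym (-(f.a * D₁)) c₁ : ℂ) * quadGaussSum c₁ 1 0)) := by
  have hAu : IsUnit ((f.a : ℤ) : ZMod c) := isUnit_intCast_of_gcd_eq_one hA
  have cop := fun {x : ℤ} {n : ℕ} (h : x.gcd n = 1) ↦ Int.isCoprime_iff_gcd_eq_one.mpr h
  have hc₁odd : Odd c₁ := (Nat.odd_mul.mp (hcs ▸ hc)).2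
  -- coprimality to `c₁ ∣ c`
  have dvd₁ : (c₁ : ℤ) ∣ (c : ℤ) := ⟨s, by rw [hcs]; push_cast; ring⟩
  have ha₁ : a.gcd c₁ = 1 := Int.isCoprime_iff_gcd_eq_one.mp ((cop ha).of_isCoprime_of_dvd_right dvd₁)
  have hA₁ : f.a.gcd c₁ = 1 :=
    Int.isCoprime_iff_gcd_eq_one.mp ((cop hA).of_isCoprime_of_dvd_right dvd₁)
  have h1 : (a * f.a).gcd c = 1 := Int.isCoprime_iff_gcd_eq_one.mp ((cop ha).mul_left (cop hA))
  have h2 : (-(a * f.a * D₁)).gcd c₁ = 1 :=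
    Int.isCoprime_iff_gcd_eq_one.mp (((cop ha₁).mul_left (cop hA₁)).mul_left (cop hD₁)).neg_left
  have hred := quadGaussSum_eq_of_dvd hcs (-(a * f.a * D₁)) 0
  simp only [Int.cast_zero, dvd_zero, if_true, Int.zero_ediv] at hred
  rw [binQuadGaussSum_zero_zero_eq_mul hc f hAu,
    show (a : ZMod c) * ((f.a : ℤ) : ZMod c) = ((a * f.a : ℤ) : ZMod c) by push_cast; ring,
    show -(((a * f.a : ℤ) : ZMod c) * ((f.disc : ℤ) : ZMod c)) =
      (((s : ℤ) * (-(a * f.a * D₁)) : ℤ) : ZMod c) by rw [hD]; push_cast; ring,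
    quadGaussSum_eq_jacobiSym_mul hc h1, hred, quadGaussSum_eq_jacobiSym_mul hc₁odd h2,
    jacobiSym.mul_left a f.a c, show -(a * f.a * D₁) = a * (-(f.a * D₁)) by ring,
    jacobiSym.mul_left a (-(f.a * D₁)) c₁]
  push_cast
  ring

/-- **The dependence on the numerator.** For odd `c = s·c₁` and a form with `(A, c) = 1` whose
discriminant factors as `D = s·D₁` with `(D₁, c₁) = 1` (so `s = (c, D)` whenever `D` is
squarefree), and `(a, c) = 1`:
`G(a, c; f, 0) = (a/s) · G(1, c; f, 0)` — the numerator enters only through the quadratic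
character `χ_s = (·/s)` (`(a/c)(a/c₁) = (a/s)(a/c₁)² = (a/s)`). For the theta series of
discriminant `−q` at a cusp `a/c`, `(c, q) = s`, this is the `χ_s(a)` of Conrey–Iwaniec's
pseudo-eigenvalue (3.15)/(3.17). [cite: AndrianovZhuravlev2015, Ch. 1 §4.4–4.5, Proposition 4.9 and Lemma 4.13] -/
theorem binQuadGaussSum_zero_zero_eq_jacobiSym_mul_binQuadGaussSum_one (hc : Odd c) (f : BinQF)
    (hA : f.a.gcd c = 1) {s c₁ : ℕ} [NeZero s] [NeZero c₁] (hcs : c = s * c₁) {D₁ : ℤ}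
    (hD : f.disc = s * D₁) (hD₁ : D₁.gcd c₁ = 1) {a : ℤ} (ha : a.gcd c = 1) :
    binQuadGaussSum c f a 0 0 = jacobiSym a s * binQuadGaussSum c f 1 0 0 := by
  have cop := fun {x : ℤ} {n : ℕ} (h : x.gcd n = 1) ↦ Int.isCoprime_iff_gcd_eq_one.mpr h
  have dvd₁ : (c₁ : ℤ) ∣ (c : ℤ) := ⟨s, by rw [hcs]; push_cast; ring⟩
  have ha₁ : a.gcd c₁ = 1 := Int.isCoprime_iff_gcd_eq_one.mp ((cop ha).of_isCoprime_of_dvd_right dvd₁)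
  have h1 : (1 : ℤ).gcd c = 1 := by simp
  have hone := binQuadGaussSum_zero_zero_eq_of_factorisation hc f hA hcs hD hD₁ h1
  simp only [Int.cast_one, jacobiSym.one_left, one_mul, mul_one] at hone
  have hsplit : jacobiSym a c = jacobiSym a s * jacobiSym a c₁ := by
    rw [hcs]; exact jacobiSym.mul_right' a (NeZero.ne s) (NeZero.ne c₁)
  rw [binQuadGaussSum_zero_zero_eq_of_factorisation hc f hA hcs hD hD₁ ha, hone, hsplit]
  have hJ : ((jacobiSym a c₁ : ℤ) : ℂ) ^ 2 = 1 := by exact_mod_cast jacobiSym.sq_one ha₁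
  push_cast
  linear_combination (jacobiSym a s : ℂ) * ((jacobiSym f.a c : ℂ) *
      quadGaussSum c 1 0 * s * ((jacobiSym (-(f.a * D₁)) c₁ : ℂ) * quadGaussSum c₁ 1 0)) * hJ

/-- **The modulus of the untwisted binary Gauss sum**: under the same hypotheses
(`c = s·c₁` odd, `D = s·D₁`, `(D₁, c₁) = 1`, `(aA, c) = 1`), `|G(a, c; f, 0)| = c·√s`
(`= √c · s · √c₁`). [cite: AndrianovZhuravlev2015, Ch. 1 §4.4–4.5, Proposition 4.9 and Lemmas 4.13–4.14] -/
theorem norm_binQuadGaussSum_zero_zero (hc : Odd c) (f : BinQF) (hA : f.a.gcd c = 1)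
    {s c₁ : ℕ} [NeZero s] [NeZero c₁] (hcs : c = s * c₁) {D₁ : ℤ} (hD : f.disc = s * D₁)
    (hD₁ : D₁.gcd c₁ = 1) {a : ℤ} (ha : a.gcd c = 1) :
    ‖binQuadGaussSum c f a 0 0‖ = c * Real.sqrt s := by
  have cop := fun {x : ℤ} {n : ℕ} (h : x.gcd n = 1) ↦ Int.isCoprime_iff_gcd_eq_one.mpr h
  have hc₁odd : Odd c₁ := (Nat.odd_mul.mp (hcs ▸ hc)).2
  have dvd₁ : (c₁ : ℤ) ∣ (c : ℤ) := ⟨s, by rw [hcs]; push_cast; ring⟩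
  have ha₁ : a.gcd c₁ = 1 := Int.isCoprime_iff_gcd_eq_one.mp ((cop ha).of_isCoprime_of_dvd_right dvd₁)
  have hA₁ : f.a.gcd c₁ = 1 :=
    Int.isCoprime_iff_gcd_eq_one.mp ((cop hA).of_isCoprime_of_dvd_right dvd₁)
  have h2 : (-(f.a * D₁)).gcd c₁ = 1 :=
    Int.isCoprime_iff_gcd_eq_one.mp ((cop hA₁).mul_left (cop hD₁)).neg_left
  have hJ := fun {x : ℤ} {n : ℕ} (h : x.gcd n = 1) ↦
    show ‖((jacobiSym x n : ℤ) : ℂ)‖ = 1 by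
      rcases jacobiSym.eq_one_or_neg_one h with h' | h' <;> simp [h']
  rw [binQuadGaussSum_zero_zero_eq_of_factorisation hc f hA hcs hD hD₁ ha]
  push_cast
  simp only [norm_mul, hJ ha, hJ ha₁, hJ hA, hJ h2, norm_quadGaussSum_one hc,
    norm_quadGaussSum_one hc₁odd, Complex.norm_natCast, one_mul]
  have hc' : (c : ℝ) = s * c₁ := by rw [hcs, Nat.cast_mul]
  rw [show Real.sqrt c = Real.sqrt s * Real.sqrt c₁ by rw [hc', Real.sqrt_mul (Nat.cast_nonneg _)],
    hc']
  have hr := Real.mul_self_sqrt (Nat.cast_nonneg c₁ : (0 : ℝ) ≤ c₁)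
  linear_combination (Real.sqrt s * s) * hr

end Literature.NumberTheory.ModularForms

end
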